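import Summits.Ventures.LatticeQCDFlow.Exactness.ReversibleVariationalSup
import HarnessLib

/-!
# `τ_int + ½` IS the variational supremum: the Dirichlet-form version of the sharpness theorem under summability

HONEST FRAMING: exact (Metropolis-corrected) sampling algorithms for lattice gauge theory;
figures of merit are autocorrelation/cost numbers at stated couplings and volumes; no
continuum-physics claim.  (SCALAR calibration rung S0-A: not a gauge result.)

Venture `LatticeQCDFlow` (cell pub-lqcd), topic `Exactness`; FANOUT row 2 (`s0-phi4`).  NEW WORK
of the cell over `Exactness/ReversibleVariationalSup.lean` (the Abel-form equality
`A_r(g) = ⨆_v (∫ g v w)²/Q_r(v)`, `0 ≤ r < 1`) and `Exactness/ReversibleVariationalTauInt.lean`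
(the test-function side at `r = 1` under summability).  Only limits of real sequences; nothing is
cited as a fact.  Printed counterparts NAMED ONLY: Kipnis–Varadhan 1986; Caracciolo–Pelissetto–Sokal
1990 (the `H₋₁` variational formula for the asymptotic variance of a reversible chain).

## What is proved (namespace `RevOp`; `C(k) = ∫ g (Kᵏ g) w`, `P = C(0)`,
## `𝓔(v) = ∫ v² w − ∫ v (K v) w`, `S_N = Σ_{k<N} Kᵏ g`)

* `tendsto_sum_range_shift_zero` — `Σ_{k<N} C(N+k) → 0` for a summable `C`;
* `tendsto_neumann_dirichlet` — `𝓔(S_N) → Σ_k C(k)` under summability of `C`;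
* **`tsum_le_of_forall_sq_inner_le_dirichlet`** — if `C` is summable, `0 ≤ B` and
  `(∫ g v w)² ≤ B · 𝓔(v)` for every `v ∈ A`, then `Σ_k C(k) ≤ B`;
* **`tauInt_add_half_eq_iSup`** — `g ∈ A`, `P > 0`, normalised series summable (the tree's standing
  hypothesis, `Scoring.tauInt`):  `τ_int(g) + ½ = (⨆_{v ∈ A} (∫ g v w)² / 𝓔(v)) / P`.

Reading: every carré-du-champ / tunnelling / sticky / variational floor of gens 13–17 is one trial
observable of this supremum; the supremum is approached along `S_N`.  NOT CLAIMED: attainment in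
`A`; non-reversible updates; any number for any run.
-/

namespace Summit.Ventures.LatticeQCDFlow.Exactness

open Real MeasureTheory Filter Finset Topology
open Summit.Ventures.LatticeQCDFlow.Scoring

namespace RevOp

variable {X : Type*} [MeasurableSpace X] {μ : Measure X} {w : X → ℝ} {A : (X → ℝ) → Prop}
  {K : (X → ℝ) → (X → ℝ)}

/-! ## At `r = 1` under summability: `τ_int + ½` is the supremum -/

/-- Under summability of `C`, the shifted block sums vanish: `Σ_{k<N} C(N+k) → 0`. -/
theorem tendsto_sum_range_shift_zero {C : ℕ → ℝ} (hs : Summable C) :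
    Tendsto (fun N : ℕ => ∑ k ∈ Finset.range N, C (N + k)) atTop (𝓝 0) := by
  have h1 := hs.hasSum.tendsto_sum_nat
  have h2 : Tendsto (fun N : ℕ => N + N) atTop atTop :=
    tendsto_atTop_mono (fun N => Nat.le_add_right N N) tendsto_id
  have h := (h1.comp h2).sub h1
  rw [sub_self] at h
  refine h.congr fun N => ?_
  show (∑ k ∈ Finset.range (N + N), C k) - ∑ k ∈ Finset.range N, C k
    = ∑ k ∈ Finset.range N, C (N + k)
  rw [Finset.sum_range_add, add_sub_cancel_left]

/-- **`𝓔(S_N) → Σ_k C(k)`** at `r = 1` under summability (`S_N = Σ_{k<N} Kᵏ g`,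
`𝓔(v) = ∫ v² w − ∫ v (K v) w`). -/
theorem tendsto_neumann_dirichlet
    (hAi : ∀ ⦃f h : X → ℝ⦄, A f → A h → Integrable (fun x => f x * h x * w x) μ)
    (hAc : ∀ ⦃f h : X → ℝ⦄ (c : ℝ), A f → A h → A (fun x => f x + c * h x))
    (hAK : ∀ ⦃f : X → ℝ⦄, A f → A (K f))
    (hlin : ∀ ⦃f h : X → ℝ⦄ (c : ℝ), A f → A h →
      ∀ x, K (fun s => f s + c * h s) x = K f x + c * K h x)
    (hsymm : ∀ ⦃f h : X → ℝ⦄, A f → A h →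
      ∫ x, K f x * h x * w x ∂μ = ∫ x, f x * K h x * w x ∂μ)
    {g : X → ℝ} (hg : A g) (hs : Summable fun k => ∫ x, g x * (K^[k] g) x * w x ∂μ) :
    Tendsto (fun N : ℕ => (∫ x, (∑ k ∈ Finset.range N, (1 : ℝ) ^ k * (K^[k] g) x) ^ 2 * w x ∂μ)
        - ∫ x, (∑ k ∈ Finset.range N, (1 : ℝ) ^ k * (K^[k] g) x)
          * K (fun y => ∑ k ∈ Finset.range N, (1 : ℝ) ^ k * (K^[k] g) y) x * w x ∂μ) atTop
      (𝓝 (∑' k, ∫ x, g x * (K^[k] g) x * w x ∂μ)) := by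
  set C : ℕ → ℝ := fun k => ∫ x, g x * (K^[k] g) x * w x ∂μ with hC
  have h1 : Tendsto (fun N : ℕ => ∑ k ∈ Finset.range N, C k) atTop (𝓝 (∑' k, C k)) :=
    hs.hasSum.tendsto_sum_nat
  have h2 := tendsto_sum_range_shift_zero hs
  have h := h1.sub h2
  rw [sub_zero] at h
  refine h.congr fun N => ?_
  have e := neumann_quadForm_eq hAi hAc hAK hlin hsymm hg 1 N
  rw [one_mul] at e
  rw [e]
  simp only [one_pow, mul_one, one_mul, hC]

/-- **LEAST-CONSTANT CHARACTERISATION AT `r = 1`.**  If `C = (C_g(k))_k` is summable, `0 ≤ B` and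
`(∫ g v w)² ≤ B · 𝓔(v)` for every `v ∈ A`, then `Σ_k C_g(k) ≤ B`. -/
theorem tsum_le_of_forall_sq_inner_le_dirichlet
    (hAi : ∀ ⦃f h : X → ℝ⦄, A f → A h → Integrable (fun x => f x * h x * w x) μ)
    (hAc : ∀ ⦃f h : X → ℝ⦄ (c : ℝ), A f → A h → A (fun x => f x + c * h x))
    (hAK : ∀ ⦃f : X → ℝ⦄, A f → A (K f))
    (hlin : ∀ ⦃f h : X → ℝ⦄ (c : ℝ), A f → A h →
      ∀ x, K (fun s => f s + c * h s) x = K f x + c * K h x)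
    (hsymm : ∀ ⦃f h : X → ℝ⦄, A f → A h →
      ∫ x, K f x * h x * w x ∂μ = ∫ x, f x * K h x * w x ∂μ)
    {g : X → ℝ} (hg : A g) (hs : Summable fun k => ∫ x, g x * (K^[k] g) x * w x ∂μ)
    {B : ℝ} (hB : 0 ≤ B)
    (h : ∀ ⦃v : X → ℝ⦄, A v → (∫ x, g x * v x * w x ∂μ) ^ 2
        ≤ B * ((∫ x, v x ^ 2 * w x ∂μ) - ∫ x, v x * K v x * w x ∂μ)) :
    ∑' k, ∫ x, g x * (K^[k] g) x * w x ∂μ ≤ B := by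
  set T := ∑' k, ∫ x, g x * (K^[k] g) x * w x ∂μ with hT
  have hL : Tendsto (fun N : ℕ =>
      (∫ x, g x * (∑ k ∈ Finset.range N, (1 : ℝ) ^ k * (K^[k] g) x) * w x ∂μ) ^ 2) atTop
      (𝓝 (T ^ 2)) := by
    have ht : Tendsto (fun N : ℕ =>
        ∫ x, g x * (∑ k ∈ Finset.range N, (1 : ℝ) ^ k * (K^[k] g) x) * w x ∂μ) atTop (𝓝 T) := by
      refine (hs.hasSum.tendsto_sum_nat).congr fun N => ?_
      rw [integral_mul_neumann hAi hAK hg 1 N]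
      simp only [one_pow, mul_one]
    exact ht.pow 2
  have hR := (tendsto_neumann_dirichlet hAi hAc hAK hlin hsymm hg hs).const_mul B
  have hstep : ∀ N : ℕ,
      (∫ x, g x * (∑ k ∈ Finset.range N, (1 : ℝ) ^ k * (K^[k] g) x) * w x ∂μ) ^ 2
        ≤ B * ((∫ x, (∑ k ∈ Finset.range N, (1 : ℝ) ^ k * (K^[k] g) x) ^ 2 * w x ∂μ)
          - ∫ x, (∑ k ∈ Finset.range N, (1 : ℝ) ^ k * (K^[k] g) x)
            * K (fun y => ∑ k ∈ Finset.range N, (1 : ℝ) ^ k * (K^[k] g) y) x * w x ∂μ) :=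
    fun N => h (neumann_mem hAc hAK hg 1 N)
  have hlim : T ^ 2 ≤ B * T := le_of_tendsto_of_tendsto' hL hR hstep
  rcases le_or_gt T 0 with hA | hA
  · exact hA.trans hB
  · nlinarith

/-- **THE VARIATIONAL FORMULA FOR `τ_int` — EQUALITY.**  `g ∈ A` with `P = C_g(0) > 0` and a
summable normalised autocorrelation series (so that `τ_int = ½ + Σ_{k≥1} ρ(k)`, `Scoring.tauInt`):
`τ_int(g) + ½ = (⨆_{v ∈ A} (∫ g v w)² / (∫ v² w − ∫ v (K v) w)) / P`.
Every floor of the tree is one trial observable of this supremum; the supremum is approached along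
`S_N = Σ_{k<N} Kᵏ g`. -/
theorem tauInt_add_half_eq_iSup (hw0 : ∀ x, 0 ≤ w x)
    (hAi : ∀ ⦃f h : X → ℝ⦄, A f → A h → Integrable (fun x => f x * h x * w x) μ)
    (hAc : ∀ ⦃f h : X → ℝ⦄ (c : ℝ), A f → A h → A (fun x => f x + c * h x))
    (hAK : ∀ ⦃f : X → ℝ⦄, A f → A (K f))
    (hlin : ∀ ⦃f h : X → ℝ⦄ (c : ℝ), A f → A h →
      ∀ x, K (fun s => f s + c * h s) x = K f x + c * K h x)
    (hsymm : ∀ ⦃f h : X → ℝ⦄, A f → A h →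
      ∫ x, K f x * h x * w x ∂μ = ∫ x, f x * K h x * w x ∂μ)
    (hcontr : ∀ ⦃f : X → ℝ⦄, A f → ∫ x, K f x ^ 2 * w x ∂μ ≤ ∫ x, f x ^ 2 * w x ∂μ)
    {g : X → ℝ} (hg : A g) (hP : 0 < ∫ x, g x ^ 2 * w x ∂μ)
    (hs : Summable fun n => (∫ x, g x * (K^[n + 1] g) x * w x ∂μ) / ∫ x, g x ^ 2 * w x ∂μ) :
    tauInt (fun n => (∫ x, g x * (K^[n] g) x * w x ∂μ) / ∫ x, g x ^ 2 * w x ∂μ) + 1 / 2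
      = (⨆ v : {v : X → ℝ // A v}, (∫ x, g x * v.1 x * w x ∂μ) ^ 2
          / ((∫ x, v.1 x ^ 2 * w x ∂μ) - ∫ x, v.1 x * K v.1 x * w x ∂μ))
        / ∫ x, g x ^ 2 * w x ∂μ := by
  set C : ℕ → ℝ := fun k => ∫ x, g x * (K^[k] g) x * w x ∂μ with hC
  set P := ∫ x, g x ^ 2 * w x ∂μ with hPdef
  set R : {v : X → ℝ // A v} → ℝ := fun v => (∫ x, g x * v.1 x * w x ∂μ) ^ 2
      / ((∫ x, v.1 x ^ 2 * w x ∂μ) - ∫ x, v.1 x * K v.1 x * w x ∂μ) with hRdef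
  haveI : Nonempty {v : X → ℝ // A v} := ⟨⟨g, hg⟩⟩
  have hC0 : C 0 = P := by
    simp only [hC, hPdef, Function.iterate_zero, id_eq]
    exact integral_congr_ae (Eventually.of_forall fun x => by ring)
  -- summability of `C` itself and `Σ' C = P (τ + ½)`
  have hsρ : Summable fun k => C k / P := (summable_nat_add_iff 1).1 hs
  have hsC : Summable C := by
    refine (hsρ.mul_left P).congr fun k => ?_
    field_simp
  have hT : ∑' k, C k = P * (tauInt (fun n => C n / P) + 1 / 2) := by
    have h1 : ∑' k, C k / P = tauInt (fun n => C n / P) + 1 / 2 := by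
      rw [hsρ.tsum_eq_zero_add, hC0, div_self hP.ne']
      simp only [tauInt]
      ring
    rw [← h1, ← tsum_mul_left]
    exact tsum_congr fun k => by field_simp
  -- every ratio is `≤ Σ' C`
  have hle : ∀ v : {v : X → ℝ // A v}, R v ≤ ∑' k, C k := by
    intro v
    have hmain := sq_inner_le_tsum_mul_dirichlet hw0 hAi hAc hAK hlin hsymm hcontr hg v.2 hs
    have hdiv : (∑' k, (∫ x, g x * (K^[k] g) x * w x ∂μ) / ∫ x, g x ^ 2 * w x ∂μ)
        = (∑' k, C k) / P := tsum_div_const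
    have e : (∫ x, g x ^ 2 * w x ∂μ) * ((∑' k, (∫ x, g x * (K^[k] g) x * w x ∂μ)
        / ∫ x, g x ^ 2 * w x ∂μ) * ((∫ x, v.1 x ^ 2 * w x ∂μ) - ∫ x, v.1 x * K v.1 x * w x ∂μ))
        = (∑' k, C k) * ((∫ x, v.1 x ^ 2 * w x ∂μ) - ∫ x, v.1 x * K v.1 x * w x ∂μ) := by
      rw [hdiv]
      show P * ((∑' k, C k) / P * ((∫ x, v.1 x ^ 2 * w x ∂μ) - ∫ x, v.1 x * K v.1 x * w x ∂μ))
        = (∑' k, C k) * ((∫ x, v.1 x ^ 2 * w x ∂μ) - ∫ x, v.1 x * K v.1 x * w x ∂μ)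
      rw [← mul_assoc, mul_div_cancel₀ _ hP.ne']
    rw [e] at hmain
    have hE0 : 0 ≤ (∫ x, v.1 x ^ 2 * w x ∂μ) - ∫ x, v.1 x * K v.1 x * w x ∂μ := by
      have := quadForm_nonneg hw0 hAi hAK hcontr v.2 zero_le_one le_rfl
      rw [one_mul] at this
      exact this
    have hT0 : 0 ≤ ∑' k, C k := by
      rw [hT]
      exact mul_nonneg hP.le (by
        have := tauInt_ge_neg_half hw0 hAi hAK hsymm hcontr hg hs
        linarith)
    simp only [hRdef]
    rcases eq_or_lt_of_le hE0 with hz | hEpos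
    · rw [← hz, div_zero]
      exact hT0
    · rw [div_le_iff₀ hEpos]
      exact hmain
  have hbdd : BddAbove (Set.range R) := ⟨∑' k, C k, by rintro _ ⟨v, rfl⟩; exact hle v⟩
  -- `⨆ R = Σ' C`
  have hsup : (⨆ v, R v) = ∑' k, C k := by
    refine le_antisymm (ciSup_le hle) ?_
    have hT0 : 0 ≤ ∑' k, C k := (show 0 ≤ R ⟨g, hg⟩ from div_nonneg (sq_nonneg _) (by
      have := quadForm_nonneg hw0 hAi hAK hcontr hg zero_le_one le_rfl
      rw [one_mul] at this
      exact this)).trans (hle ⟨g, hg⟩)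
    rcases eq_or_lt_of_le hT0 with hz | hTpos
    · rw [← hz]
      refine le_trans ?_ (le_ciSup hbdd ⟨g, hg⟩)
      exact div_nonneg (sq_nonneg _) (by
        have := quadForm_nonneg hw0 hAi hAK hcontr hg zero_le_one le_rfl
        rw [one_mul] at this
        exact this)
    · have hnum : Tendsto (fun N : ℕ =>
          (∫ x, g x * (∑ k ∈ Finset.range N, (1 : ℝ) ^ k * (K^[k] g) x) * w x ∂μ) ^ 2) atTop
          (𝓝 ((∑' k, C k) ^ 2)) := by
        have ht : Tendsto (fun N : ℕ =>
            ∫ x, g x * (∑ k ∈ Finset.range N, (1 : ℝ) ^ k * (K^[k] g) x) * w x ∂μ) atTop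
            (𝓝 (∑' k, C k)) := by
          refine (hsC.hasSum.tendsto_sum_nat).congr fun N => ?_
          rw [integral_mul_neumann hAi hAK hg 1 N]
          simp only [one_pow, mul_one, hC]
        exact ht.pow 2
      have hden := tendsto_neumann_dirichlet hAi hAc hAK hlin hsymm hg hsC
      have hratio := hnum.div hden hTpos.ne'
      have e : (∑' k, C k) ^ 2 / (∑' k, C k) = ∑' k, C k := by
        rw [sq, mul_div_assoc, div_self hTpos.ne', mul_one]
      rw [e] at hratio
      refine le_of_tendsto' hratio fun N => ?_
      exact le_ciSup hbdd ⟨_, neumann_mem hAc hAK hg (1 : ℝ) N⟩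
  rw [hsup, hT]
  simp only [hC]
  rw [mul_div_cancel_left₀ _ hP.ne']

end RevOp

end Summit.Ventures.LatticeQCDFlow.Exactness
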